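import Summits.QuantumAdvantage.QuantumAdvantage.Theorems.SparsityDialB

/-! # SparsityDial — part 3/3 (mechanical split for landing of `SparsityDial`; content verbatim; scopes re-opened with their variables) -/

set_option linter.dupNamespace false
set_option linter.unusedVariables false
noncomputable section
open scoped Classical

namespace Summit.QuantumAdvantage.QuantumAdvantage.Theorems.SparsityDial
open Finset
open Literature.Computability.QuantumComplexity Literature.Computability.QuantumComplexity.RingHLF
open Literature.Computability.MetaComplexity Literature.Computability.MetaComplexity.Smolensky
open Summit.QuantumAdvantage.AdviceFreeQNC0
open Summit.QuantumAdvantage.QuantumAdvantage.Theses (ExactnessDial.PolyLossOddU3 ExactnessDial.DPLift3)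
open Summit.QuantumAdvantage.QuantumAdvantage.Theorems.HolonomyDial (selP selP_mem selP_apply xorP xorP_mem
  xorP_apply_bool tPoly tPoly_mem tPoly_apply closes_T)
open Summit.QuantumAdvantage.QuantumAdvantage.Theorems.AnchorDial (outB dev loss_shape_mono card_odd_ge)
open Summit.QuantumAdvantage.QuantumAdvantage.Theorems.LocusDial (Coverable FewLocus FewLocusLossOne3
  coverable_mono_m Coverable.card_le dev_tPoly fewLocusLossOne3_of_fewLocusLoss3)
open Summit.QuantumAdvantage.QuantumAdvantage.Theorems.StabilizerDial (StabFew pad pad_mem winset_pad deg_pad_stab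
  stabFew_of_fewLocus bitP bitP_pad rowMask apIdx apStrat apStrat_mem bitP_apStrat mem_dev_pad_apStrat_iff BlockRec
  fibreIdentityAt_of_block oddSliceBound_holds goodBound_of_blockRec blockSelect_of_fewLocus eventually_polylog
  side_bounds polyLossOddU3_of_stabPos stabGenericLossPos3_of_polyLossOddU3 antipodalGenericPos3)
variable {N : ℕ}

/-! ### E2 — a literally polylog-sparse family with NO cheap one-point normal form

The BLOCK-ANTIPODAL family `P♭`: antipodal (`t_j ⊕ [x_{j+⌊N/2⌋}]`) on the `6k` consecutive positions `[1, 1+6k)`,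
canonical (`t_j`) elsewhere, with `k = kBlk N e = 3456·(8(log₂ N)^e+1)²` the block length of `goodBound_of_blockRec`.
Its deviation set lives on the block (literal `6k`-point sparsity, zero gauge); and a gauge `s` of degree `(log₂ N)^e`
leaving a.e. `≤ 1` deviation leaves, for each such input, the block recurrence intact on `≥ 5` of the `6` sub-blocks —
against `goodBound_of_blockRec` (each sub-block's recurrence holds on `≤ 3/4` of the odd class): `5·(1 - 1/16) > 6·(3/4)`. -/

/-- the block length of the landed good-bound lemma at gauge level `e`. -/
def kBlk (N e : ℕ) : ℕ := 3456 * (8 * (Nat.log 2 N) ^ e + 1) ^ 2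

/-- SparsityDial helper `kBlk_le` (decomp-qadv land package; see the module docstring). -/
theorem kBlk_le {N : ℕ} (e : ℕ) (hL : 1 ≤ Nat.log 2 N) : kBlk N e ≤ 279936 * (Nat.log 2 N) ^ (2 * e) := by
  have hLe : 1 ≤ (Nat.log 2 N) ^ e := Nat.one_le_pow _ _ hL
  have h81 : (8 * (Nat.log 2 N) ^ e + 1) ^ 2 ≤ 81 * ((Nat.log 2 N) ^ e) ^ 2 := by nlinarith
  calc kBlk N e = 3456 * (8 * (Nat.log 2 N) ^ e + 1) ^ 2 := rfl
    _ ≤ 3456 * (81 * ((Nat.log 2 N) ^ e) ^ 2) := Nat.mul_le_mul_left _ h81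
    _ = 279936 * (Nat.log 2 N) ^ (2 * e) := by ring

/-- SparsityDial helper `three_le_kBlk` (decomp-qadv land package; see the module docstring). -/
theorem three_le_kBlk (N e : ℕ) : 3 ≤ kBlk N e :=
  calc (3 : ℕ) ≤ 3456 * 1 := by norm_num
    _ ≤ 3456 * (8 * (Nat.log 2 N) ^ e + 1) ^ 2 := Nat.mul_le_mul_left _ (Nat.one_le_pow _ _ (by omega))

/-- **THE BLOCK-ANTIPODAL FAMILY** `P♭_j := t_j ⊕ [x_{j+⌊N/2⌋}]` for `1 ≤ j < 1 + 6k`, `:= t_j` otherwise (degree `3`). -/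
def bpStrat (k : ℕ) (j : Fin N) : CubeFn (ZMod 3) N :=
  if 1 ≤ j.val ∧ j.val < 1 + 6 * k then apStrat j else tPoly j

/-- SparsityDial helper `bpStrat_mem` (decomp-qadv land package; see the module docstring). -/
theorem bpStrat_mem (k : ℕ) (j : Fin N) : bpStrat k j ∈ lowDeg (ZMod 3) N 3 := by
  unfold bpStrat
  split_ifs
  · exact apStrat_mem j
  · exact lowDeg_mono (by norm_num) (tPoly_mem j)

/-- off the block the family never deviates from the canonical guess. -/
theorem mem_block_of_mem_dev_bpStrat (k : ℕ) (x : Fin N → Bool) (j : Fin N)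
    (hj : j ∈ dev (fun i : Fin N => bpStrat k i) x) : 1 ≤ j.val ∧ j.val < 1 + 6 * k := by
  by_contra hnot
  have hb : bpStrat k j = tPoly j := by unfold bpStrat; rw [if_neg hnot]
  have hne : decide (bpStrat k j x = 1) ≠ tGuess x j := by simpa [dev] using hj
  rw [hb, tPoly_apply] at hne
  revert hne
  cases tGuess x j <;> simp

/-- on the block, position `j` is a deviation of the PADDED family iff the block recurrence fails at `j`
(`mem_dev_pad_apStrat_iff`; `pad P s j` depends on `P` only through `P j`). -/
theorem mem_dev_pad_bpStrat_iff (k : ℕ) (s : Fin N → CubeFn (ZMod 3) N) (x : Fin N → Bool) (j : Fin N)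
    (hj : 1 ≤ j.val ∧ j.val < 1 + 6 * k) :
    j ∈ dev (pad (fun i : Fin N => bpStrat k i) s) x ↔ rowMask s x j ≠ x (apIdx j) := by
  rw [← mem_dev_pad_apStrat_iff s x j]
  have hb : bpStrat k j = apStrat j := by unfold bpStrat; rw [if_pos hj]
  have hp : pad (fun i : Fin N => bpStrat k i) s j = pad (fun i : Fin N => apStrat i) s j := by
    simp only [pad, hb]
  simp only [dev, mem_filter, mem_univ, true_and, hp]

/-- **E2(a)**: the block-antipodal family is LITERALLY `t`-point-sparse for `t ≥ 6k` (zero gauge). -/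
theorem fewLocus_bpStrat (k t : ℕ) (ht : 6 * k ≤ t) : FewLocus t 0 (fun j : Fin N => bpStrat k j) := by
  have hcov : ∀ x : Fin N → Bool, Coverable t 0 (dev (fun j : Fin N => bpStrat k j) x) := by
    intro x
    refine ⟨fun i => 1 + i.val, fun j hj => ?_⟩
    have hblk := mem_block_of_mem_dev_bpStrat k x j hj
    exact ⟨⟨j.val - 1, by omega⟩, by dsimp only; omega⟩
  have hempty : (univ.filter fun x : Fin N → Bool =>
      OddZeros x ∧ ¬ Coverable t 0 (dev (fun j : Fin N => bpStrat k j) x)) = ∅ :=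
    filter_eq_empty_iff.mpr fun x _ h => h.2 (hcov x)
  show Nat.log 2 N * _ ≤ _
  rw [hempty, card_empty, mul_zero]
  exact Nat.zero_le _

/-- **E2(b)**: … hence CHEAPLY `(log₂ N)^a`-point-sparse at every gauge level once `(log₂ N)^a ≥ 6k`. -/
theorem stabFew_bpStrat (k a e : ℕ) (h : 6 * k ≤ (Nat.log 2 N) ^ a) :
    StabFew ((Nat.log 2 N) ^ a) 0 e (fun j : Fin N => bpStrat k j) :=
  stabFew_of_fewLocus e (fewLocus_bpStrat k _ h)

/-- **E2(c)**: at block length `kBlk n e` the block-antipodal family has NO cheap one-point normal form at level `e`. -/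
theorem bpStrat_not_pointer (e : ℕ) : ∃ n₀ : ℕ, ∀ n ≥ n₀,
    ¬ StabFew 1 0 e (fun j : Fin n => bpStrat (kBlk n e) j) := by
  obtain ⟨n₀, hn₀⟩ := eventually_polylog (6 * 279936 + 2) (2 * e)
  refine ⟨n₀, fun n hn hStab => ?_⟩
  obtain ⟨hKn, hL⟩ := hn₀ n hn
  obtain ⟨s, hs, hF⟩ := hStab
  set L := Nat.log 2 n with hLdef
  set k := kBlk n e with hkdef
  have hL1 : 1 ≤ L := le_trans (by norm_num) hL
  have hk_le : k ≤ 279936 * L ^ (2 * e) := kBlk_le e hL1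
  have hLL : 1 ≤ L ^ (2 * e) := Nat.one_le_pow _ _ hL1
  have h6k : 6 * k + 2 ≤ n / 2 := by nlinarith
  have hk3 : 3 ≤ k := three_le_kBlk n e
  have hkk : 3456 * (8 * L ^ e + 1) ^ 2 ≤ k := le_of_eq (by rw [hkdef]; rfl)
  -- the six sub-blocks `[1 + i k, 1 + (i+1) k)`, `i < 6`
  have ha1 : ∀ i : ℕ, 1 ≤ 1 + i * k := fun i => Nat.le_add_right _ _
  have hak : ∀ i < 6, 1 + i * k + k + 1 ≤ n / 2 := by
    intro i hi
    have : i * k ≤ 5 * k := Nat.mul_le_mul_right k (by omega)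
    omega
  have hGB : ∀ i < 6, 8 * (univ.filter fun x : Fin n → Bool => OddZeros x ∧ BlockRec s (1 + i * k) k x).card ≤ 3 * 2 ^ n :=
    fun i hi => goodBound_of_blockRec n e (1 + i * k) k s hs hkk (ha1 i) (hak i hi)
      (fibreIdentityAt_of_block n (1 + i * k) k hk3 (ha1 i) (hak i hi)) (oddSliceBound_holds n)
  -- the good set (a.e. at most one deviation) and the exceptional set
  set Q := 2 ^ (n - 1) with hQdef
  set Good := (univ.filter fun x : Fin n → Bool =>
    OddZeros x ∧ Coverable 1 0 (dev (pad (fun j : Fin n => bpStrat k j) s) x)) with hGooddef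
  set Bad := (univ.filter fun x : Fin n → Bool =>
    OddZeros x ∧ ¬ Coverable 1 0 (dev (pad (fun j : Fin n => bpStrat k j) s) x)).card with hBaddef
  have hBad : L * Bad ≤ Q := hF
  have hBad16 : 16 * Bad ≤ Q := le_trans (Nat.mul_le_mul_right _ hL) hBad
  have hn3 : 3 ≤ n := by
    have : 6 * k + 2 ≤ n := le_trans h6k (Nat.div_le_self _ _)
    omega
  have hOdd : Q ≤ Good.card + Bad := by
    calc Q ≤ (univ.filter fun x : Fin n → Bool => OddZeros x).card := card_odd_ge (by omega)
      _ ≤ Good.card + Bad := by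
        rw [hGooddef, hBaddef, ← Finset.card_union_of_disjoint]
        · refine card_le_card fun x hx => ?_
          rw [mem_filter] at hx
          rw [mem_union, mem_filter, mem_filter]
          by_cases hB : Coverable 1 0 (dev (pad (fun j : Fin n => bpStrat k j) s) x)
          · exact Or.inl ⟨hx.1, hx.2, hB⟩
          · exact Or.inr ⟨hx.1, hx.2, hB⟩
        · rw [Finset.disjoint_left]
          intro x h1 h2
          rw [mem_filter] at h1 h2
          exact h2.2.2 h1.2.2
  -- KEY: a good input violates the block recurrence on AT MOST ONE sub-block
  have hex : ∀ x ∈ Good, ∀ i < 6, ¬ BlockRec s (1 + i * k) k x →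
      ∃ v : ℕ, 1 + i * k ≤ v ∧ v < 1 + i * k + k ∧
        ∀ j ∈ dev (pad (fun j : Fin n => bpStrat k j) s) x, j.val = v := by
    intro x hx i hi hB
    rw [hGooddef, mem_filter] at hx
    obtain ⟨kv, hkv⟩ := hx.2.2
    have hB' : ∃ j : Fin n, 1 + i * k ≤ j.val ∧ j.val < 1 + i * k + k ∧ rowMask s x j ≠ x (apIdx j) := by
      by_contra hcon
      push Not at hcon
      exact hB fun j hj1 hj2 => hcon j hj1 hj2
    obtain ⟨j, hj1, hj2, hj3⟩ := hB'
    have hi5 : i * k ≤ 5 * k := Nat.mul_le_mul_right k (by omega)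
    have hblk : 1 ≤ j.val ∧ j.val < 1 + 6 * k := ⟨le_trans (ha1 i) hj1, by omega⟩
    have hmem : j ∈ dev (pad (fun i : Fin n => bpStrat k i) s) x := (mem_dev_pad_bpStrat_iff k s x j hblk).mpr hj3
    have hval : ∀ j' ∈ dev (pad (fun j : Fin n => bpStrat k j) s) x, j'.val = kv 0 := by
      intro j' hj'
      obtain ⟨q, hq1, hq2⟩ := hkv j' hj'
      have hq : q = 0 := Subsingleton.elim _ _
      subst hq
      omega
    exact ⟨kv 0, by rw [← hval j hmem]; exact hj1, by rw [← hval j hmem]; exact hj2, hval⟩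
  have hkey : ∀ x ∈ Good, ∀ i < 6, ∀ i' < 6, ¬ BlockRec s (1 + i * k) k x → ¬ BlockRec s (1 + i' * k) k x → i = i' := by
    intro x hx i hi i' hi' hB hB'
    obtain ⟨v, hv1, hv2, hv⟩ := hex x hx i hi hB
    obtain ⟨v', hv'1, hv'2, hv'⟩ := hex x hx i' hi' hB'
    -- both exceptional values are THE value of the (non-empty) deviation set
    have hB1 : ∃ j : Fin n, 1 + i * k ≤ j.val ∧ j.val < 1 + i * k + k ∧ rowMask s x j ≠ x (apIdx j) := by
      by_contra hcon
      push Not at hcon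
      exact hB fun j hj1 hj2 => hcon j hj1 hj2
    obtain ⟨j, hj1, hj2, hj3⟩ := hB1
    have hi5 : i * k ≤ 5 * k := Nat.mul_le_mul_right k (by omega)
    have hblk : 1 ≤ j.val ∧ j.val < 1 + 6 * k := ⟨le_trans (ha1 i) hj1, by omega⟩
    have hmem : j ∈ dev (pad (fun i : Fin n => bpStrat k i) s) x := (mem_dev_pad_bpStrat_iff k s x j hblk).mpr hj3
    have e1 := hv j hmem
    have e2 := hv' j hmem
    have hi'5 : i' * k ≤ 5 * k := Nat.mul_le_mul_right k (by omega)
    interval_cases i <;> interval_cases i' <;> omega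
  -- COUNTING.  F i := the good inputs whose recurrence fails on sub-block i: pairwise disjoint, inside Good
  have hdisj : (↑(range 6) : Set ℕ).PairwiseDisjoint
      (fun i => Good.filter fun x => ¬ BlockRec s (1 + i * k) k x) := by
    intro i hi i' hi' hne
    rw [Function.onFun, Finset.disjoint_left]
    intro x hx hx'
    rw [mem_filter] at hx hx'
    exact hne (hkey x hx.1 i (mem_range.mp (Finset.mem_coe.mp hi)) i' (mem_range.mp (Finset.mem_coe.mp hi')) hx.2 hx'.2)
  have hUnion : ∑ i ∈ range 6, (Good.filter fun x => ¬ BlockRec s (1 + i * k) k x).card ≤ Good.card := by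
    rw [← card_biUnion hdisj]
    exact card_le_card (biUnion_subset.mpr fun i _ => filter_subset _ _)
  have hcover : ∀ i : ℕ, Good.card ≤ (univ.filter fun x : Fin n → Bool => OddZeros x ∧ BlockRec s (1 + i * k) k x).card
      + (Good.filter fun x => ¬ BlockRec s (1 + i * k) k x).card := by
    intro i
    refine le_trans (card_le_card fun x hx => ?_) (card_union_le _ _)
    rw [mem_union, mem_filter, mem_filter]
    by_cases hB : BlockRec s (1 + i * k) k x
    · have hx' := hx
      rw [hGooddef, mem_filter] at hx'
      exact Or.inl ⟨mem_univ _, hx'.2.1, hB⟩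
    · exact Or.inr ⟨hx, hB⟩
  set Sg := ∑ i ∈ range 6, (univ.filter fun x : Fin n → Bool => OddZeros x ∧ BlockRec s (1 + i * k) k x).card
    with hSgdef
  have hsum : 6 * Good.card ≤ Sg + Good.card := by
    calc 6 * Good.card = ∑ i ∈ range 6, Good.card := by simp
      _ ≤ ∑ i ∈ range 6, ((univ.filter fun x : Fin n → Bool => OddZeros x ∧ BlockRec s (1 + i * k) k x).card
            + (Good.filter fun x => ¬ BlockRec s (1 + i * k) k x).card) := sum_le_sum fun i _ => hcover i
      _ = Sg + ∑ i ∈ range 6, (Good.filter fun x => ¬ BlockRec s (1 + i * k) k x).card := by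
            rw [hSgdef, sum_add_distrib]
      _ ≤ Sg + Good.card := Nat.add_le_add_left hUnion _
  have hSg : 8 * Sg ≤ 6 * (3 * 2 ^ n) := by
    calc 8 * Sg = ∑ i ∈ range 6, 8 * (univ.filter fun x : Fin n → Bool =>
          OddZeros x ∧ BlockRec s (1 + i * k) k x).card := by rw [hSgdef, mul_sum]
      _ ≤ ∑ i ∈ range 6, 3 * 2 ^ n := sum_le_sum fun i hi => hGB i (mem_range.mp hi)
      _ = 6 * (3 * 2 ^ n) := by simp
  have h2n : 2 ^ n = Q * 2 := by
    rw [hQdef, ← pow_succ]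
    congr 1
    omega
  have hQ : 0 < Q := Nat.two_pow_pos _
  rw [h2n] at hSg
  omega

/-- **E2, pointed form**: the block-antipodal family at block length `kBlk n (c+1)` has degree `≤ (log₂ n)^c`, a cheap
(indeed literal) `(log₂ n)^{2c+23}`-point normal form, and NO cheap one-point normal form at level `c+1`. -/
theorem bpStrat_in_sparse_class (c : ℕ) (hc : 1 ≤ c) :
    ∃ n₀ : ℕ, ∀ n ≥ n₀,
      (∀ i : Fin n, bpStrat (kBlk n (c + 1)) i ∈ lowDeg (ZMod 3) n ((Nat.log 2 n) ^ c)) ∧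
        StabFew ((Nat.log 2 n) ^ (2 * c + 23)) 0 (c + 1) (fun j : Fin n => bpStrat (kBlk n (c + 1)) j) ∧
          ¬ StabFew 1 0 (c + 1) (fun j : Fin n => bpStrat (kBlk n (c + 1)) j) := by
  obtain ⟨n₀, hn₀⟩ := bpStrat_not_pointer (c + 1)
  refine ⟨max n₀ 8, fun n hn => ⟨fun i => ?_, ?_, hn₀ n (le_trans (le_max_left _ _) hn)⟩⟩
  · have h8 : 2 ^ 3 ≤ n := le_trans (le_max_right _ _) hn
    have hL : 3 ≤ Nat.log 2 n := Nat.le_log_of_pow_le (by norm_num) h8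
    have h3 : 3 ≤ (Nat.log 2 n) ^ c :=
      calc 3 ≤ Nat.log 2 n := hL
        _ = (Nat.log 2 n) ^ 1 := (pow_one _).symm
        _ ≤ (Nat.log 2 n) ^ c := Nat.pow_le_pow_right (by omega) hc
    exact lowDeg_mono h3 (bpStrat_mem _ i)
  · refine stabFew_bpStrat _ _ (c + 1) ?_
    have h8 : 2 ^ 3 ≤ n := le_trans (le_max_right _ _) hn
    have hL : 3 ≤ Nat.log 2 n := Nat.le_log_of_pow_le (by norm_num) h8
    set L := Nat.log 2 n with hLdef
    have hk := kBlk_le (N := n) (c + 1) (by omega)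
    -- 6·279936·L^{2c+2} ≤ 2^21·L^{2c+2} ≤ L^21·L^{2c+2} = L^{2c+23}  (L ≥ 2)
    have h21 : 6 * 279936 ≤ L ^ 21 := le_trans (by norm_num) (Nat.pow_le_pow_left (by omega : 2 ≤ L) 21)
    calc 6 * kBlk n (c + 1) ≤ 6 * (279936 * L ^ (2 * (c + 1))) := Nat.mul_le_mul_left _ hk
      _ = (6 * 279936) * L ^ (2 * (c + 1)) := by ring
      _ ≤ L ^ 21 * L ^ (2 * (c + 1)) := Nat.mul_le_mul_right _ h21
      _ = L ^ (2 * c + 23) := by rw [← pow_add]; congr 1; omega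

/-- **S_a's hypothesis class is inhabited for every `a ≥ 2c + 23`** (by a degree-3 family; what `D` never speaks
about): `D = DenseGenericLoss3` is STRICTLY weaker than `G`. -/
theorem sparse_generic_class_nonempty (a c : ℕ) (hc : 1 ≤ c) (ha : 2 * c + 23 ≤ a) :
    ∃ n₀ : ℕ, ∀ n ≥ n₀, ∃ P : Fin n → CubeFn (ZMod 3) n,
      (∀ i, P i ∈ lowDeg (ZMod 3) n ((Nat.log 2 n) ^ c)) ∧
        StabFew ((Nat.log 2 n) ^ a) 0 (c + 1) P ∧ ¬ StabFew 1 0 (c + 1) P := by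
  obtain ⟨n₀, hn₀⟩ := bpStrat_in_sparse_class c hc
  refine ⟨max n₀ 2, fun n hn => ?_⟩
  obtain ⟨h1, h2, h3⟩ := hn₀ n (le_of_max_le_left hn)
  refine ⟨fun j => bpStrat (kBlk n (c + 1)) j, h1, ?_, h3⟩
  exact stabFew_mono_mr (Nat.pow_le_pow_right (Nat.le_log_of_pow_le (by norm_num)
    (by simpa using le_of_max_le_right hn)) ha) (one_le_logpow (le_of_max_le_right hn) _) le_rfl h2

/-- the two certificates side by side: at every scale `a ≥ 2c + 23` BOTH hypothesis classes of the split are inhabited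
by explicit degree-`3` families — neither piece is vacuous, neither is `G`. -/
theorem split_nondegenerate (a c : ℕ) (hc : 1 ≤ c) (ha : 2 * c + 23 ≤ a) :
    ∃ n₀ : ℕ, ∀ n ≥ n₀,
      (∃ P : Fin n → CubeFn (ZMod 3) n, (∀ i, P i ∈ lowDeg (ZMod 3) n ((Nat.log 2 n) ^ c)) ∧
        StabFew ((Nat.log 2 n) ^ a) 0 (c + 1) P ∧ ¬ StabFew 1 0 (c + 1) P) ∧
      (∃ P : Fin n → CubeFn (ZMod 3) n, (∀ i, P i ∈ lowDeg (ZMod 3) n ((Nat.log 2 n) ^ c)) ∧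
        ¬ StabFew ((Nat.log 2 n) ^ a) 0 (c + 1) P) := by
  obtain ⟨n₁, h₁⟩ := sparse_generic_class_nonempty a c hc ha
  obtain ⟨n₂, h₂⟩ := dense_class_nonempty a c hc
  exact ⟨max n₁ n₂, fun n hn => ⟨h₁ n (le_of_max_le_left hn), h₂ n (le_of_max_le_right hn)⟩⟩

/-! ## §5  FIRST RUNGS of the two pieces (typed targets, NOT pieces): each piece restricted to its certificate family.
`D → AntipodalLoss3` and `S → BlockAntipodalLoss3` BY NAME (the certificate families lie in the respective classes);
instrument «apwin-v0» (local, exact, n ≤ 28): the antipodal family wins `≈ 0.50` of the odd class for odd `n` and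
`0.81 → 0.60` (decreasing) for even `n`; toy block-antipodal families (block 3, 6) win `→ 0.5000`; so both rungs assert a
loss of order `1/2 ≫ n^{-C}` — plausible, INSTRUMENTABLE, and (two-arc transfer matrix of constant size) ATTACKABLE. -/

/-- **rung of D**: the antipodal family loses a noticeable fraction of the odd class. -/
def AntipodalLoss3 : Prop :=
  ∃ C n₀ : ℕ, ∀ n ≥ n₀,
    ((univ.filter fun x : Fin n → Bool => OddZeros x ∧ Rel x (fun i => decide (apStrat i x = 1))).card : ℝ) ≤
      (1 - 1 / (n : ℝ) ^ C) * (2 : ℝ) ^ (n - 1)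

/-- **rung of S**: the block-antipodal family (level `2`, block `kBlk n 2`) loses a noticeable fraction of the odd class. -/
def BlockAntipodalLoss3 : Prop :=
  ∃ C n₀ : ℕ, ∀ n ≥ n₀,
    ((univ.filter fun x : Fin n → Bool => OddZeros x ∧ Rel x (fun i => decide (bpStrat (kBlk n 2) i x = 1))).card : ℝ) ≤
      (1 - 1 / (n : ℝ) ^ C) * (2 : ℝ) ^ (n - 1)

/-- `D → AntipodalLoss3` (E1: the antipodal family is in `D_a`'s class at every scale; degree `3 ≤ (log₂ n)^1`). -/
theorem antipodalLoss3_of_dense (h : DenseGenericLoss3) : AntipodalLoss3 := by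
  obtain ⟨a, C, hC⟩ := h
  obtain ⟨n₁, hn₁⟩ := hC 1
  -- (`dense_class_nonempty` is existential; use the pointed fact `apStrat_not_polylogSparse` for `apStrat` itself)
  obtain ⟨n₃, hn₃⟩ := apStrat_not_polylogSparse a (1 + 1)
  refine ⟨C, max (max n₁ n₃) 8, fun n hn => ?_⟩
  have hn1 : n₁ ≤ n := le_trans (le_trans (le_max_left _ _) (le_max_left _ _)) hn
  have hn3 : n₃ ≤ n := le_trans (le_trans (le_max_right _ _) (le_max_left _ _)) hn
  have h8 : 2 ^ 3 ≤ n := le_trans (le_max_right _ _) hn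
  have hL : 3 ≤ Nat.log 2 n := Nat.le_log_of_pow_le (by norm_num) h8
  have hdeg : ∀ i : Fin n, apStrat i ∈ lowDeg (ZMod 3) n ((Nat.log 2 n) ^ 1) := fun i =>
    lowDeg_mono (by simpa using hL) (apStrat_mem i)
  exact hn₁ n hn1 (fun i => apStrat i) hdeg (hn₃ n hn3)

/-- `S → BlockAntipodalLoss3` (E2: the block-antipodal family is in `S_25`'s class; degree `3 ≤ (log₂ n)^1`). -/
theorem blockAntipodalLoss3_of_sparse (h : SparseGenericLoss3) : BlockAntipodalLoss3 := by
  obtain ⟨C, hC⟩ := h (2 * 1 + 23)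
  obtain ⟨n₁, hn₁⟩ := hC 1
  obtain ⟨n₂, hn₂⟩ := bpStrat_in_sparse_class 1 le_rfl
  refine ⟨C, max n₁ n₂, fun n hn => ?_⟩
  obtain ⟨h1, h2, h3⟩ := hn₂ n (le_of_max_le_right hn)
  exact hn₁ n (le_of_max_le_left hn) _ h1 h2 h3

end Summit.QuantumAdvantage.QuantumAdvantage.Theorems.SparsityDial

end
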